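import Literature.NumberTheory.Automorphic.BaseChangeArchimedeanRankOne
import Literature.NumberTheory.GaloisRepresentations.HeckeCharacterAutConj
import HarnessLib

/-!
# The archimedean parameter of an automorphic representation of `GL₁(𝔸_K)` whose Hecke character
# is algebraic: `ι ↦ {-n_ι}` (proofs)

Topic `NumberTheory/Automorphic`; proof file (theorems only: no definition, no named fact, no
instance). Let `π = W / W'` be an automorphic representation of `GL₁(𝔸_K)` in the Borel–Jacquet model
of the tree, with Hecke character `θ` (`r(g) φ - θ(det g) φ ∈ W'`,
`AutomorphicRepData.exists_heckeCharacter_glOne`), and suppose `θ` has infinity type `(p, q)` in the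
sense of `HeckeCharacter.HasInfinityType` (`θ((x,1)) = ∏_w ι_w(x_w)^{-p_w} \overline{ι_w(x_w)}^{-q_w}`
near `1`; exponents `n_φ = embExponent p q φ`). This file computes the archimedean (Harish-Chandra)
parameter of `π` — the converse direction of the tree's
`AutomorphicRepData.exists_hasInfinityType_heckeCharacter_glOne` (`ReciprocityGLnRankOneProofs`:
datum ↦ algebraic character):

* `AutomorphicRepData.hasArchParameter_of_hasInfinityType_heckeCharacter_glOne` — **`π` has
  archimedean parameter `ι ↦ {-n_ι}`**. The Lie algebra `𝔤𝔩₁(K_∞)` acts on the line `W / W'`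
  through a real linear form `d` with `θ(det (exp Y, 1)) = e^{d(Y)}`
  (`heckeCharacter_glOne_det_ofArch_expMem`); since `det (exp Y, 1)` is a totally positive infinite
  idele, `θ(det (exp Y, 1)) = A_{p,q}` of it (`HasInfinityType.apply_infiniteIdeles_eq`), i.e.
  `e^{-(p_w + q_w) r}` along `Y = r · 1_w` at a real place and `e^{-(p_w a + q_w ā)}` along `Y = a_w`
  at a complex one (`extensionEmbedding_det_ofInfinite_expGL_realPlaceLie/complexPlaceLie`); so
  `d(1_w) = -(p_w + q_w)` and `d(a_w) = -(p_w a + q_w ā)` (`eq_of_forall_cexp_mul_eq`), whose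
  `τ`-projections are `-p_w`, `-q_w`, and `hasArchParameter_glOne_of_eq_smul_one` applies.
* `AutomorphicRepData.map_a_eq_of_hasInfinityType_heckeCharacter_glOne` — by uniqueness of the
  archimedean parameter (`hasArchParameter_unique`), **every infinity type `T` of `π` has
  `a`-multiset `{-n_ι}` at `ι`**; and
  `AutomorphicRepData.exists_hasInfinityType_of_hasInfinityType_heckeCharacter_glOne` — `π` has the
  infinity type `ι ↦ {(-n_ι, -n_ῑ)}`.

This is the `n = 1` dictionary "type à l'infini of `π_θ` = infinity type of `θ`" (Clozel 1990, §1.1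
and §3.3; Weil 1956, §1) behind the archimedean half of clause (ii) of Clozel's Thm. 3.13 for
`n = 1` (`ClozelAlgebraicity`).

## References

* L. Clozel, *Motifs et formes automorphes* (1990), §1.1, §3.3, Thm. 3.13. [Clozel1990]
* A. Weil, *On a certain type of characters of the idèle-class group of an algebraic
  number-field* (1956), §1. [Weil1956]
* A. W. Knapp, *Lie Groups Beyond an Introduction* (2002), Thm. 5.44. [Knapp2002]
-/

-- Mathlib idiom (Mathlib/Algebra/Lie/OfAssociative.lean): the commutator bracket on matrices,
-- needed to mention `𝔤 →ₗ⁅ℝ⁆ End V` (as in `AutomorphicRepsGLOneArchParameter`)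
attribute [local instance 100] LieRing.ofAssociativeRing

noncomputable section

open scoped MatrixGroups Matrix Classical NumberField ComplexConjugate
open NumberField NumberField.InfinitePlace NumberField.mixedEmbedding IsDedekindDomain

namespace Literature.NumberTheory.Automorphic

open Literature.NumberTheory.GaloisRepresentations

variable {K : Type} [Field K] [NumberField K]

/-! ### §1. The exponential ideles `det (exp Y, 1)` as totally positive infinite ideles -/

/-- An idele with trivial finite part is the infinite idele of its infinite part. [folklore] -/
theorem infiniteIdeles_infPart_of_snd_eq_one (z : ideleGroup K) (hz : (z : AdeleRing (𝓞 K) K).2 = 1) :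
    infiniteIdeles K (HeckeCharacter.infPart K z) = z :=
  idele_eq_of_snd_eq_of_extensionEmbedding_eq K (by rw [hz]; rfl) fun _ ↦ rfl

/-- `det (exp Y, 1)` is `((exp Y)_∞, 1)`. [folklore] -/
theorem infiniteIdeles_infPart_det_ofInfinite_expGL (Y : Matrix (Fin 1) (Fin 1) (mixedSpace K)) :
    infiniteIdeles K (HeckeCharacter.infPart K
      (Matrix.GeneralLinearGroup.det (GLn.ofInfinite 1 K (expGL Y)))) =
      Matrix.GeneralLinearGroup.det (GLn.ofInfinite 1 K (expGL Y)) :=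
  infiniteIdeles_infPart_of_snd_eq_one _ (det_ofInfinite_snd K _)

/-- **`det (exp Y, 1)` is totally positive**: its real coordinates are `e^{Y_w} > 0`. [folklore] -/
theorem isTotallyPositive_infPart_det_ofInfinite_expGL (Y : Matrix (Fin 1) (Fin 1) (mixedSpace K)) :
    InfiniteIdele.IsTotallyPositive (HeckeCharacter.infPart K
      (Matrix.GeneralLinearGroup.det (GLn.ofInfinite 1 K (expGL Y)))) := by
  intro w hw
  have h := extensionEmbedding_det_ofInfinite_expGL_of_isReal K Y ⟨w, hw⟩
  rw [← Completion.extensionEmbeddingOfIsReal_apply hw] at h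
  have h' : Completion.extensionEmbeddingOfIsReal hw
      ((((Matrix.GeneralLinearGroup.det (GLn.ofInfinite 1 K (expGL Y)) : (AdeleRing (𝓞 K) K)ˣ) :
        AdeleRing (𝓞 K) K).1) w) = Real.exp ((Y 0 0).1 ⟨w, hw⟩) := Complex.ofReal_injective h
  change 0 < Completion.extensionEmbeddingOfIsReal hw
    ((((Matrix.GeneralLinearGroup.det (GLn.ofInfinite 1 K (expGL Y)) : (AdeleRing (𝓞 K) K)ˣ) :
      AdeleRing (𝓞 K) K).1) w)
  rw [h']
  exact Real.exp_pos _

/-- **An algebraic Hecke character on the exponential ideles**: if `θ` has infinity type `(p, q)`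
then `θ(det (exp Y, 1)) = A_{p,q}((exp Y)_∞)` (the infinity type governs `θ` on all totally
positive infinite ideles, `HasInfinityType.apply_infiniteIdeles_eq`). [cite: Weil1956, §1] -/
theorem _root_.Literature.NumberTheory.GaloisRepresentations.HeckeCharacter.HasInfinityType.apply_det_ofInfinite_expGL
    {θ : HeckeCharacter K} {p q : InfinitePlace K → ℤ}
    (hθ : θ.HasInfinityType p q) (Y : Matrix (Fin 1) (Fin 1) (mixedSpace K)) :
    ((θ (Matrix.GeneralLinearGroup.det (GLn.ofInfinite 1 K (expGL Y))) : ℂˣ) : ℂ) =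
      HeckeCharacter.archFactor p q (HeckeCharacter.infPart K
        (Matrix.GeneralLinearGroup.det (GLn.ofInfinite 1 K (expGL Y)))) := by
  have h := hθ.apply_infiniteIdeles_eq (isTotallyPositive_infPart_det_ofInfinite_expGL Y)
  rwa [infiniteIdeles_infPart_det_ofInfinite_expGL] at h

/-- **Along a real place**: `A_{p,q}((exp (r · 1_w))_∞) = e^{-(p_w + q_w) r}`. [folklore] -/
theorem archFactor_infPart_det_ofInfinite_expGL_realPlaceLie (p q : InfinitePlace K → ℤ)
    (w : {w : InfinitePlace K // w.IsReal}) (r : ℝ) :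
    HeckeCharacter.archFactor p q (HeckeCharacter.infPart K
      (Matrix.GeneralLinearGroup.det (GLn.ofInfinite 1 K
        (expGL (realPlaceLie 1 w (r • (1 : Matrix (Fin 1) (Fin 1) ℝ))))))) =
      Complex.exp ((r : ℂ) * (-((p w.1 : ℂ) + q w.1))) := by
  rw [HeckeCharacter.archFactor_apply]
  simp only [HeckeCharacter.val_infPart]
  simp_rw [extensionEmbedding_det_ofInfinite_expGL_realPlaceLie K w r]
  rw [Finset.prod_eq_single w.1 (fun w' _ hw' ↦ by rw [if_neg hw']; simp)
      (fun h ↦ absurd (Finset.mem_univ _) h),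
    if_pos rfl, Complex.ofReal_exp, ← Complex.exp_conj, Complex.conj_ofReal,
    ← zpow_add₀ (Complex.exp_ne_zero _), ← Complex.exp_int_mul]
  congr 1
  push_cast
  ring

/-- **Along a complex place**: `A_{p,q}((exp a_w)_∞) = e^{-(p_w a + q_w ā)}`. [folklore] -/
theorem archFactor_infPart_det_ofInfinite_expGL_complexPlaceLie (p q : InfinitePlace K → ℤ)
    (w : {w : InfinitePlace K // w.IsComplex}) (a : ℂ) :
    HeckeCharacter.archFactor p q (HeckeCharacter.infPart K
      (Matrix.GeneralLinearGroup.det (GLn.ofInfinite 1 K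
        (expGL (complexPlaceLie 1 w (a • (1 : Matrix (Fin 1) (Fin 1) ℂ))))))) =
      Complex.exp (-((p w.1 : ℂ) * a + q w.1 * conj a)) := by
  rw [HeckeCharacter.archFactor_apply]
  simp only [HeckeCharacter.val_infPart]
  simp_rw [extensionEmbedding_det_ofInfinite_expGL_complexPlaceLie K w a]
  rw [Finset.prod_eq_single w.1 (fun w' _ hw' ↦ by rw [if_neg hw']; simp)
      (fun h ↦ absurd (Finset.mem_univ _) h),
    if_pos rfl, ← Complex.exp_conj, ← Complex.exp_int_mul, ← Complex.exp_int_mul, ← Complex.exp_add]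
  congr 1
  push_cast
  ring

/-! ### §2. The archimedean parameter of `π` from the infinity type of its Hecke character -/

section GLOne

variable {hcpt : isCompact_glFiniteIntegralLevel 1 K}

/-- The real algebra endomorphisms of `ℂ` are `id` and `conj`, and they differ. [folklore] -/
theorem univ_algHom_complex_eq :
    (Finset.univ : Finset (ℂ →ₐ[ℝ] ℂ)) = {AlgHom.id ℝ ℂ, (Complex.conjAe : ℂ →ₐ[ℝ] ℂ)} ∧
      AlgHom.id ℝ ℂ ≠ (Complex.conjAe : ℂ →ₐ[ℝ] ℂ) := by
  refine ⟨?_, fun h ↦ ?_⟩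
  · ext τ
    simp only [Finset.mem_univ, Finset.mem_insert, Finset.mem_singleton, true_iff]
    exact Complex.real_algHom_eq_id_or_conj τ
  · have h1 : (Complex.I : ℂ) = conj Complex.I := congrArg (fun f : ℂ →ₐ[ℝ] ℂ ↦ f Complex.I) h
    rw [Complex.conj_I] at h1
    exact Complex.I_ne_zero (by linear_combination h1 / 2)

/-- **The archimedean parameter of an automorphic representation of `GL₁(𝔸_K)` whose Hecke
character has infinity type `(p, q)` is `ι ↦ {-n_ι}`** (`n_ι = embExponent p q ι`: `p_w + q_w` at a
real place, `p_w` at `σ_w`, `q_w` at `σ̄_w`). With `d` the real linear form through which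
`𝔤𝔩₁(K_∞)` acts on `W / W'`: `e^{d(Y)} = θ(det (exp Y, 1)) = A_{p,q}((exp Y)_∞)`
(`heckeCharacter_glOne_det_ofArch_expMem`, `HasInfinityType.apply_det_ofInfinite_expGL`), hence
`d(1_w) = -(p_w + q_w)` (real `w`) and `d(a_w) = -(p_w a + q_w ā)` (complex `w`), whose
`τ`-projections at `1` are `-p_w` (`τ = id`) and `-q_w` (`τ = conj`); conclude by
`hasArchParameter_glOne_of_eq_smul_one`. Clozel 1990, §1.1 and §3.3 (`n = 1`: the infinity type of
`π_θ` is that of `θ`); Knapp 2002, Thm. 5.44. [cite: Clozel1990, §3.3] [cite: Weil1956, §1] -/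
theorem AutomorphicRepData.hasArchParameter_of_hasInfinityType_heckeCharacter_glOne
    (π : AutomorphicRepData (AutomorphyDatum.gl 1 K hcpt)) {θ : HeckeCharacter K}
    (hχ : ∀ (g : (AdelicGroupData.gl 1 K).Adelic), ∀ φ ∈ π.W,
      rightTranslation (AdelicGroupData.gl 1 K) g φ -
        ((θ (Matrix.GeneralLinearGroup.det g) : ℂˣ) : ℂ) • φ ∈ π.W')
    {p q : InfinitePlace K → ℤ} (hθ : θ.HasInfinityType p q) :
    π.HasArchParameter fun ι ↦ {-((HeckeCharacter.embExponent p q ι : ℤ) : ℂ)} := by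
  classical
  -- the Lie algebra acts on the line `W / W'` through the real linear form `d`
  obtain ⟨ρ, hρ⟩ := π.exists_hasLieAction_gl
  obtain ⟨d', hd'⟩ := π.exists_linearMap_lieAction_eq_smul_one_glOne ρ
  obtain ⟨d, hd⟩ : ∃ d : Matrix (Fin 1) (Fin 1) (mixedSpace K) →ₗ[ℝ] ℂ,
      ∀ Y, d Y = d' ⟨Y, trivial⟩ :=
    ⟨{ toFun := fun Y => d' ⟨Y, trivial⟩
       map_add' := fun Y Z => map_add d' ⟨Y, trivial⟩ ⟨Z, trivial⟩
       map_smul' := fun c Y => map_smul d' c ⟨Y, trivial⟩ }, fun _ => rfl⟩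
  -- the link `θ(det (exp Y, 1)) = e^{d(Y)}`
  have hlink : ∀ Y : Matrix (Fin 1) (Fin 1) (mixedSpace K),
      Complex.exp (d Y) = HeckeCharacter.archFactor p q (HeckeCharacter.infPart K
        (Matrix.GeneralLinearGroup.det (GLn.ofInfinite 1 K (expGL Y)))) := by
    intro Y
    have h := π.heckeCharacter_glOne_det_ofArch_expMem hχ ⟨Y, trivial⟩
      (fun φ hφ => π.lieDeriv_sub_smul_mem_of_hasLieAction_glOne hρ hd' ⟨Y, trivial⟩ hφ) 1
    rw [one_smul, Complex.ofReal_one, one_mul, ← hd] at h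
    rw [← h]
    exact hθ.apply_det_ofInfinite_expGL Y
  -- at a real place: `d(1_w) = -(p_w + q_w)`
  have hreal : ∀ w : {w : InfinitePlace K // w.IsReal},
      d (realPlaceLie 1 w (1 : Matrix (Fin 1) (Fin 1) ℝ)) = -((p w.1 : ℂ) + q w.1) := by
    intro w
    refine eq_of_forall_cexp_mul_eq fun t ↦ ?_
    have h := hlink (realPlaceLie 1 w (t • (1 : Matrix (Fin 1) (Fin 1) ℝ)))
    rw [archFactor_infPart_det_ofInfinite_expGL_realPlaceLie, map_smul, map_smul,
      Complex.real_smul] at h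
    exact h
  -- at a complex place: `d(a_w) = -(p_w a + q_w ā)`
  have hcomplex : ∀ (w : {w : InfinitePlace K // w.IsComplex}) (a : ℂ),
      d (complexPlaceLie 1 w (a • (1 : Matrix (Fin 1) (Fin 1) ℂ))) = -((p w.1 : ℂ) * a + q w.1 * conj a) := by
    intro w a
    refine eq_of_forall_cexp_mul_eq fun t ↦ ?_
    have h := hlink (complexPlaceLie 1 w (((t : ℂ) * a) • (1 : Matrix (Fin 1) (Fin 1) ℂ)))
    rw [archFactor_infPart_det_ofInfinite_expGL_complexPlaceLie] at h
    have hsm : ((t : ℂ) * a) • (1 : Matrix (Fin 1) (Fin 1) ℂ) = t • (a • (1 : Matrix (Fin 1) (Fin 1) ℂ)) := by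
      rw [← smul_assoc, Complex.real_smul]
    rw [hsm, map_smul, map_smul, Complex.real_smul, map_mul, Complex.conj_ofReal] at h
    rw [h]
    congr 1
    ring
  -- the clauses of `hasArchParameter_glOne_of_eq_smul_one`
  obtain ⟨huniv, hne⟩ := univ_algHom_complex_eq
  refine π.hasArchParameter_glOne_of_eq_smul_one hρ d' hd' (fun w ↦ ?_) (fun w τ ↦ ?_)
  · -- real place: `-n_{σ_w} = -(p_w + q_w) = d(1_w)`
    rw [← hd, hreal w]
    congr 1
    have hre : ComplexEmbedding.IsReal w.1.embedding := isReal_iff.mp w.2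
    unfold HeckeCharacter.embExponent
    rw [if_pos hre, mk_embedding]
    push_cast
    ring
  · -- complex place: the `τ`-projections of `a ↦ d(a_w)` at `1`
    have hfun : (fun a : ℂ => d' ⟨complexPlaceLie 1 w (a • (1 : Matrix (Fin 1) (Fin 1) ℂ)), trivial⟩) =
        fun a : ℂ => -((p w.1 : ℂ) * a + q w.1 * conj a) :=
      funext fun a ↦ (hd _).symm.trans (hcomplex w a)
    have hcard : (Fintype.card (ℂ →ₐ[ℝ] ℂ) : ℂ) = 2 := by
      rw [← Finset.card_univ, huniv, Finset.card_pair hne]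
      norm_num
    have hnr : ¬ ComplexEmbedding.IsReal w.1.embedding := fun h ↦
      (not_isReal_iff_isComplex.mpr w.2) (isReal_iff.mpr h)
    have hnr' : ¬ ComplexEmbedding.IsReal (ComplexEmbedding.conjugate w.1.embedding) := by
      rwa [ComplexEmbedding.isReal_conjugate_iff]
    have hneq : ComplexEmbedding.conjugate w.1.embedding ≠ w.1.embedding := fun h ↦
      hnr (ComplexEmbedding.isReal_iff.mpr h)
    rw [hfun, HCEmb.proj_def, hcard]
    congr 1
    rcases Complex.real_algHom_eq_id_or_conj τ with rfl | rfl
    · -- `τ = id`: `-n_{σ_w} = -p_w`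
      rw [algHomId_toRingHom_comp]
      unfold HeckeCharacter.embExponent
      rw [if_neg hnr, mk_embedding, if_pos rfl]
      change -(p w.1 : ℂ) = (2 : ℂ)⁻¹ • (-((p w.1 : ℂ) * 1 + q w.1 * conj 1) +
        conj (Complex.I) • -((p w.1 : ℂ) * (Complex.I • (1 : ℂ)) + q w.1 * conj (Complex.I • (1 : ℂ))))
      simp only [smul_eq_mul, mul_one, map_one, Complex.conj_I]
      linear_combination ((q w.1 : ℂ) - p w.1) / 2 * Complex.I_mul_I
    · -- `τ = conj`: `-n_{σ̄_w} = -q_w`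
      rw [conjAe_toRingHom_comp]
      unfold HeckeCharacter.embExponent
      rw [if_neg hnr', mk_conjugate_eq, mk_embedding, if_neg hneq]
      change -(q w.1 : ℂ) = (2 : ℂ)⁻¹ • (-((p w.1 : ℂ) * 1 + q w.1 * conj 1) +
        conj (conj Complex.I) • -((p w.1 : ℂ) * (Complex.I • (1 : ℂ)) + q w.1 * conj (Complex.I • (1 : ℂ))))
      simp only [smul_eq_mul, mul_one, map_one, map_neg, Complex.conj_I, neg_neg]
      linear_combination ((p w.1 : ℂ) - q w.1) / 2 * Complex.I_mul_I

/-- **Every infinity type of `π` has `a`-multiset `{-n_ι}` at `ι`** when the Hecke character of `π`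
has infinity type `(p, q)` (uniqueness of the archimedean parameter,
`AutomorphicRepData.hasArchParameter_unique`). [cite: Clozel1990, §3.3] -/
theorem AutomorphicRepData.map_a_eq_of_hasInfinityType_heckeCharacter_glOne
    (π : AutomorphicRepData (AutomorphyDatum.gl 1 K hcpt)) {θ : HeckeCharacter K}
    (hχ : ∀ (g : (AdelicGroupData.gl 1 K).Adelic), ∀ φ ∈ π.W,
      rightTranslation (AdelicGroupData.gl 1 K) g φ -
        ((θ (Matrix.GeneralLinearGroup.det g) : ℂˣ) : ℂ) • φ ∈ π.W')
    {p q : InfinitePlace K → ℤ} (hθ : θ.HasInfinityType p q) {T : InfinityType K 1}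
    (hT : π.HasInfinityType T) (ι : K →+* ℂ) :
    (T ι).map ArchWeight.a = {-((HeckeCharacter.embExponent p q ι : ℤ) : ℂ)} :=
  congr_fun (π.hasArchParameter_unique hT.2
    (π.hasArchParameter_of_hasInfinityType_heckeCharacter_glOne hχ hθ)) ι

/-- **`π` has the infinity type `ι ↦ {(-n_ι, -n_ῑ)}`** when its Hecke character has infinity type
`(p, q)` (well formed: `n_{\bar{ῑ}} = n_ι`; archimedean parameter
`hasArchParameter_of_hasInfinityType_heckeCharacter_glOne`). Clozel 1990, §1.1 and §3.3 (`n = 1`).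
[cite: Clozel1990, §3.3] -/
theorem AutomorphicRepData.exists_hasInfinityType_of_hasInfinityType_heckeCharacter_glOne
    (π : AutomorphicRepData (AutomorphyDatum.gl 1 K hcpt)) {θ : HeckeCharacter K}
    (hχ : ∀ (g : (AdelicGroupData.gl 1 K).Adelic), ∀ φ ∈ π.W,
      rightTranslation (AdelicGroupData.gl 1 K) g φ -
        ((θ (Matrix.GeneralLinearGroup.det g) : ℂˣ) : ℂ) • φ ∈ π.W')
    {p q : InfinitePlace K → ℤ} (hθ : θ.HasInfinityType p q) :
    ∃ T : InfinityType K 1, π.HasInfinityType T ∧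
      ∀ ι : K →+* ℂ, (T ι).map ArchWeight.a = {-((HeckeCharacter.embExponent p q ι : ℤ) : ℂ)} := by
  let T : InfinityType K 1 := fun ι ↦
    {⟨-((HeckeCharacter.embExponent p q ι : ℤ) : ℂ),
      -((HeckeCharacter.embExponent p q (ComplexEmbedding.conjugate ι) : ℤ) : ℂ),
      ⟨-HeckeCharacter.embExponent p q ι + HeckeCharacter.embExponent p q (ComplexEmbedding.conjugate ι),
        by push_cast; ring⟩⟩}
  have hTa : ∀ ι : K →+* ℂ, (T ι).map ArchWeight.a = {-((HeckeCharacter.embExponent p q ι : ℤ) : ℂ)} :=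
    fun ι ↦ by simp [T]
  refine ⟨T, ⟨⟨fun ι ↦ by simp [T], fun ι ↦ ?_⟩, ?_⟩, hTa⟩
  · -- compatibility with complex conjugation
    simp only [T, Multiset.map_singleton]
    congr 1
    ext
    · rfl
    · simp [ArchWeight.swap, ComplexEmbedding.involutive_conjugate K ι]
  · have h := π.hasArchParameter_of_hasInfinityType_heckeCharacter_glOne hχ hθ
    have hfun : (fun σ ↦ (T σ).map ArchWeight.a) =
        fun ι ↦ {-((HeckeCharacter.embExponent p q ι : ℤ) : ℂ)} := funext hTa
    rw [hfun]
    exact h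

end GLOne

end Literature.NumberTheory.Automorphic
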